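import Literature.NumberTheory.EllipticCurves.Gamma0QuotientStokesProofs
import Literature.NumberTheory.EllipticCurves.Gamma0UnfoldingProofs
import Literature.NumberTheory.EllipticCurves.HyperbolicBandIntegralProofs
import Literature.NumberTheory.EllipticCurves.DualFormPotentialProofs
import Literature.NumberTheory.EllipticCurves.RealPeriodCocycleProofs
import Literature.NumberTheory.EllipticCurves.PastenSpectralDegreeHomologyProofs
import Mathlib.NumberTheory.ModularForms.Bounds
import HarnessLib

/-!
# Riemann's period relations for `X₀(N)` in Petersson form, and Pasten's Theorem 5.5

Definitions and theorems; discharges the named fact `PastenShimura2024_thm_5_5`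
(`PastenShimura2024_thm_5_5_holds`). The tree had reduced Pasten's Theorem 5.5 (*Shimura curves
and the abc conjecture*, §5.6: `deg φ ∣ ∏_{𝔭 ≠ I_f} η_f(𝔭)`) to **Riemann's period relations for
`X₀(N)` in Petersson form** (`PastenShimura2024_thm_5_5_of_periodRelations`; hypothesis `hRB`:
for `ψ` in the period homology `H ⊆ S₂(Γ₀(N))^∨` with Petersson–Riesz representative `h` and
`φ ∈ H`, `im φ(h) ∈ 4π²ℤ` — Farkas–Kra III.1.1 (1.1.1), II.3.3, III.2.3 on the compact Riemann
surface `X₀(N)`). This file proves `hRB` on `ℍ` (`PeriodRelations.periodRelations`), assembling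
the bricks `Gamma0QuotientStokesProofs` (Stokes on `Γ₀(N)∖ℍ`), `Gamma0UnfoldingProofs`
(unfolding), `HyperbolicBandIntegralProofs` (the band integral of a hyperbolic element),
`DualFormPotentialProofs` (the potential `U` of the dual form of a closed geodesic, integrality
of its periods `p(γ)`) and `RealPeriodCocycleProofs` (a real cusp cocycle is `re` of the periods
of a cusp form):

* `PeriodRelations.Setup` — the data attached to a hyperbolic `δ₀ ∈ Γ₀(N)` (`exists_setup`);
  `Setup.isCuspCocycle` — `k ↦ U(k τ_Y) - U(τ_Y)` is a real cusp cocycle, so there is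
  `u ∈ S₂(Γ₀(N))` with `re {∞, γ∞}_u = p(γ) ∈ ℤ` (`Setup.exists_cuspForm`);
* `Setup.Φ_smul`, `Setup.exists_bound_Φ`, `Setup.exists_bound_Φ'` — `Φ = U - re E_u`
  (`E_u = 2πi∫_{i∞} u`) is `Γ₀(N)`-invariant, bounded, real-`C¹` with `‖Φ'‖ ≤ M'/y` (Mathlib's
  `ModularGroup.exists_bound_of_subgroup_invariant`);
* **`Setup.peterssonProduct_eq`** — `⟨u, f⟩ = i · sign(ℓ) · {∞, δ₀∞}_f / (4π²)` for every
  `f ∈ S₂(Γ₀(N))` (Stokes: `∫ y² f ∂Φ/∂z̄ = 0`; the `re E_u`-part is `-2πi⟨u, f⟩`; the `U`-part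
  unfolds to the band integral `sign(ℓ){∞, δ₀∞}_f/(2π)`) — Farkas–Kra (1.1.1)
  `∫_b ω = ∬ ω ∧ *η_b` for the closed geodesic `b` of `δ₀`;
* `Setup.exists_rieszRep` — hence `h_{δ₀} = 4π² sign(ℓ) i u` represents `{∞, δ₀∞}` and has
  `im {∞, γ∞}_{h_{δ₀}} = 4π² sign(ℓ) p(γ) ∈ 4π²ℤ`;
* `periodFunctional_mem_closure_hyperbolic` — every period functional is an integral
  combination of those of hyperbolic elements (`γ¹² = 1` if `(tr γ)² ≤ 1`;
  `tr(γA) + tr(γA⁻¹) = tr γ · tr A` with `A = (1 1; N N+1)`);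
* **`PeriodRelations.periodRelations`** (`hRB`) and **`PastenShimura2024_thm_5_5_holds`**.

## References

* [PastenShimura2024] H. Pasten, *Shimura curves and the abc conjecture*, J. Number Theory 254
  (2024) 214–335 / arXiv:1705.09251: Thm. 5.5, §5.6.
* [FarkasKra1992] H. M. Farkas, I. Kra, *Riemann Surfaces*, GTM 71: II.3.3, III.1.1 (1.1.1),
  III.2.3.
-/

noncomputable section

open MeasureTheory Set Filter Topology Complex CongruenceSubgroup ModularGroup
open scoped ComplexConjugate UpperHalfPlane MatrixGroups ModularForm Real Modular

namespace Literature.NumberTheory.EllipticCurves.ModularForms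

namespace PeriodRelations

variable {N : ℕ}

/-! ### The real part of the Eichler integral and its derivative -/

/-- **The derivative of `re E_u`**, `E_u = 2πi ∫_{i∞} u`: the real-linear map
`h ↦ re(2πi u(z) h)`, as a `ℂ`-valued form. [folklore] -/
def reEichlerDeriv (u : CuspForm (Gamma0 N) 2) (z : ℂ) : ℂ →L[ℝ] ℂ :=
  Complex.ofRealCLM.comp
    ((2 * π * I * u (UpperHalfPlane.ofComplex z)).re • Complex.reCLM -
      (2 * π * I * u (UpperHalfPlane.ofComplex z)).im • Complex.imCLM)

/-- `reEichlerDeriv u z h = re(2πi u(z) h)`. [folklore] -/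
@[simp] theorem reEichlerDeriv_apply (u : CuspForm (Gamma0 N) 2) (z h : ℂ) :
    reEichlerDeriv u z h = (((2 * π * I * u (UpperHalfPlane.ofComplex z) * h).re : ℝ) : ℂ) := by
  simp only [reEichlerDeriv, ContinuousLinearMap.coe_comp, Function.comp_apply, _root_.sub_apply,
    FunLike.coe_smul, Pi.smul_apply, Complex.reCLM_apply, Complex.imCLM_apply, smul_eq_mul,
    Complex.ofRealCLM_apply, Complex.mul_re]

/-- **`re E_u` is differentiable** with derivative `reEichlerDeriv` (`E_u' = 2πi u`,
`hasDerivAt_eichlerIntegral`). [folklore] -/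
theorem hasFDerivAt_re_eichlerIntegral [NeZero N] (u : CuspForm (Gamma0 N) 2) {z : ℂ} (hz : 0 < z.im) :
    HasFDerivAt (fun z : ℂ ↦ (((eichlerIntegral u (UpperHalfPlane.ofComplex z)).re : ℝ) : ℂ))
      (reEichlerDeriv u z) z := by
  have hE := (hasDerivAt_eichlerIntegral u hz).hasFDerivAt.restrictScalars ℝ
  have h := Complex.ofRealCLM.hasFDerivAt.comp z (Complex.reCLM.hasFDerivAt.comp z hE)
  refine HasFDerivAt.congr_fderiv h ?_
  ext h'
  simp only [ContinuousLinearMap.coe_comp, Function.comp_apply, ContinuousLinearMap.coe_restrictScalars',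
    Complex.reCLM_apply, Complex.ofRealCLM_apply, reEichlerDeriv_apply,
    ContinuousLinearMap.toSpanSingleton_apply, smul_eq_mul]
  rw [mul_comm h']

/-- **The `∂/∂z̄`-part of `D(re E_u)`**: `P(1) + i P(i) = \overline{2πi u(z)}`. [folklore] -/
theorem reEichlerDeriv_dbar (u : CuspForm (Gamma0 N) 2) (z : ℂ) :
    reEichlerDeriv u z 1 + I * reEichlerDeriv u z I = conj (2 * π * I * u (UpperHalfPlane.ofComplex z)) := by
  apply Complex.ext <;> simp [reEichlerDeriv_apply]

/-- `reEichlerDeriv` is continuous on the upper half-plane. [folklore] -/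
theorem continuousOn_reEichlerDeriv [NeZero N] (u : CuspForm (Gamma0 N) 2) :
    ContinuousOn (reEichlerDeriv u) {z : ℂ | 0 < z.im} := by
  have hu : ContinuousOn (fun z : ℂ ↦ u (UpperHalfPlane.ofComplex z)) {z : ℂ | 0 < z.im} :=
    (isCuspFunction_one u).continuousOn_comp_ofComplex
  have hc : ContinuousOn (fun z : ℂ ↦ 2 * π * I * u (UpperHalfPlane.ofComplex z)) {z : ℂ | 0 < z.im} :=
    continuousOn_const.mul hu
  unfold reEichlerDeriv
  exact continuousOn_const.clm_comp
    (((Complex.continuous_re.comp_continuousOn hc).smul continuousOn_const).sub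
      ((Complex.continuous_im.comp_continuousOn hc).smul continuousOn_const))

/-- `‖D(re E_u)(z)‖ ≤ 2π |u(z)|`. [folklore] -/
theorem norm_reEichlerDeriv_le (u : CuspForm (Gamma0 N) 2) (z : ℂ) :
    ‖reEichlerDeriv u z‖ ≤ 2 * π * ‖u (UpperHalfPlane.ofComplex z)‖ := by
  refine ContinuousLinearMap.opNorm_le_bound _ (by positivity) fun h ↦ ?_
  rw [reEichlerDeriv_apply, Complex.norm_real, Real.norm_eq_abs]
  refine (Complex.abs_re_le_norm _).trans ?_
  have e : ‖(2 : ℂ) * (π : ℂ) * I * u (UpperHalfPlane.ofComplex z)‖ = 2 * π * ‖u (UpperHalfPlane.ofComplex z)‖ := by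
    simp [abs_of_pos Real.pi_pos]
  rw [norm_mul, e]

/-! ### The set-up attached to a hyperbolic element of `Γ₀(N)` -/

/-- **The data of the construction** for a hyperbolic `δ₀ ∈ Γ₀(N)`: adapted coordinate
`w = (z-ξ₁)/(z-ξ₂)` (`w(δ₀z) = κ w(z)`), band half-width `ε`, and a height `Y₀` above all
`SL(2, ℤ)`-translates of the band (`DualForm.exists_height_bound`). [folklore] -/
structure Setup (N : ℕ) where
  /-- the hyperbolic element -/
  δ₀ : Gamma0 N
  /-- the attracting/repelling fixed points and the multiplier -/
  ξ₁ : ℝ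
  ξ₂ : ℝ
  κ : ℝ
  /-- the band half-width -/
  ε : ℝ
  hξ : ξ₂ < ξ₁
  hκ : 0 < κ
  hκ1 : κ ≠ 1
  hw : ∀ z : ℂ, 0 < z.im →
    (moebius (δ₀ : SL(2, ℤ)) z - ξ₁) / (moebius (δ₀ : SL(2, ℤ)) z - ξ₂) = κ * ((z - ξ₁) / (z - ξ₂))
  hε : 0 < ε
  hε' : ε < π / 2
  /-- the height bound -/
  Y₀ : ℝ
  hY₀ : 0 < Y₀
  hY : ∀ (s : SL(2, ℤ)) (σ : ℍ),
    Complex.arg (((σ : ℂ) - ξ₁) / ((σ : ℂ) - ξ₂)) ∈ Icc (π / 2 - ε) (π / 2 + ε) → (s • σ).im ≤ Y₀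

/-- **Every hyperbolic element of `Γ₀(N)` has a set-up** (`HypStrip.exists_coords_of_hyperbolic`,
`DualForm.exists_height_bound`, `ε = π/4`). [folklore] -/
theorem exists_setup (δ : SL(2, ℤ)) (hδ : δ ∈ Gamma0 N) (htr : 4 < (δ 0 0 + δ 1 1) ^ 2) :
    ∃ S : Setup N, S.δ₀ = ⟨δ, hδ⟩ := by
  obtain ⟨ξ₁, ξ₂, κ, hξ, hκ, hκ1, hw⟩ := HypStrip.exists_coords_of_hyperbolic δ htr
  have hε : (0 : ℝ) < π / 4 := by positivity
  have hε' : π / 4 < π / 2 := by linarith [Real.pi_pos]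
  obtain ⟨Y₀, hY₀, hY⟩ := DualForm.exists_height_bound (δ₀ := (⟨δ, hδ⟩ : Gamma0 N)) (ε := π / 4)
    hξ hκ hκ1 hw hε'
  exact ⟨⟨⟨δ, hδ⟩, ξ₁, ξ₂, κ, π / 4, hξ, hκ, hκ1, hw, hε, hε', Y₀, hY₀, hY⟩, rfl⟩

namespace Setup

variable (S : Setup N)

/-- The potential `U` (base point `i`). [folklore] -/
def U (τ : ℍ) : ℝ := DualForm.dualPotential S.δ₀ S.ξ₁ S.ξ₂ S.ε UpperHalfPlane.I τ

/-- Its derivative `U'`. [folklore] -/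
def U' (z : ℂ) : ℂ →L[ℝ] ℝ := DualForm.dualPotentialDeriv S.δ₀ S.ξ₁ S.ξ₂ S.ε z

/-- The periods `p(γ)`. [folklore] -/
def p (γ : Gamma0 N) : ℝ := DualForm.dualPeriod S.δ₀ S.ξ₁ S.ξ₂ S.ε UpperHalfPlane.I γ

/-- The high point `i(Y₀ + 1)`. [folklore] -/
def τY : ℍ := ⟨((S.Y₀ + 1 : ℝ) : ℂ) * I, by simp; linarith [S.hY₀]⟩

/-- `im τY = Y₀ + 1`. [folklore] -/
@[simp] theorem τY_im : S.τY.im = S.Y₀ + 1 := by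
  show (((S.Y₀ + 1 : ℝ) : ℂ) * I).im = S.Y₀ + 1
  simp

/-- **The cusp cocycle of `U`**: `ι(k) = U(k τY) - U(τY)`, the value of `U` on the horoball at the
cusp `k∞` minus its value on the horoball at `∞`. [folklore] -/
def ι (k : SL(2, ℤ)) : ℝ := S.U (k • S.τY) - S.U S.τY

/-- `U(γτ) = U(τ) + p(γ)`. [folklore] -/
theorem U_smul (γ : Gamma0 N) (τ : ℍ) : S.U (((γ : SL(2, ℤ))) • τ) = S.U τ + S.p γ :=
  DualForm.dualPotential_smul S.hξ S.hκ S.hκ1 S.hw S.hε S.hε' _ γ τ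

/-- `U` is constant on the horoballs `s · {im > Y₀}`. [folklore] -/
theorem U_eq_of_height (s : SL(2, ℤ)) {τ τ' : ℍ} (hτ : S.Y₀ < (s⁻¹ • τ).im) (hτ' : S.Y₀ < (s⁻¹ • τ').im) :
    S.U τ = S.U τ' :=
  DualForm.dualPotential_eq_of_height S.hξ S.hκ S.hκ1 S.hw S.hε S.hε' S.hY _ s hτ hτ'

/-- **`ι` is a real cusp cocycle.** [folklore] -/
theorem isCuspCocycle : RealCocycle.IsCuspCocycle N S.ι where
  apply_eq_zero k hk := by
    obtain ⟨n, rfl | rfl⟩ := RealCocycle.eq_T_zpow_or_neg k hk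
    · rw [ι, sub_eq_zero]
      refine S.U_eq_of_height 1 ?_ ?_
      · rw [inv_one, one_smul, ModularGroup.im_T_zpow_smul, τY_im]; linarith
      · rw [inv_one, one_smul, τY_im]; linarith
    · rw [ι, sub_eq_zero, ModularGroup.SL_neg_smul]
      refine S.U_eq_of_height 1 ?_ ?_
      · rw [inv_one, one_smul, ModularGroup.im_T_zpow_smul, τY_im]; linarith
      · rw [inv_one, one_smul, τY_im]; linarith
  mul_T_zpow k m := by
    rw [ι, ι, sub_left_inj, mul_smul]
    refine S.U_eq_of_height k ?_ ?_
    · rw [inv_smul_smul, ModularGroup.im_T_zpow_smul, τY_im]; linarith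
    · rw [inv_smul_smul, τY_im]; linarith
  neg k := by rw [ι, ι, ModularGroup.SL_neg_smul]
  mul_of_mem {g} hg k := by
    have h1 := S.U_smul ⟨g, hg⟩ (k • S.τY)
    have h2 := S.U_smul ⟨g, hg⟩ S.τY
    simp only [ι, mul_smul]
    rw [show ((⟨g, hg⟩ : Gamma0 N) : SL(2, ℤ)) = g from rfl] at h1 h2
    rw [h1, h2]; ring

/-- `ι(γ) = p(γ)` on `Γ₀(N)`. [folklore] -/
theorem ι_coe (γ : Gamma0 N) : S.ι (γ : SL(2, ℤ)) = S.p γ := by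
  rw [ι, S.U_smul]; ring

/-- **The cusp form `u` with `re {∞, γ∞}_u = p(γ)`** (`RealCocycle.exists_cuspForm_re_cuspSymbol_eq`). [folklore] -/
theorem exists_cuspForm [NeZero N] : ∃ u : CuspForm (Gamma0 N) 2, ∀ γ : Gamma0 N, (cuspSymbol u γ).re = S.p γ := by
  obtain ⟨u, hu⟩ := RealCocycle.exists_cuspForm_re_cuspSymbol_eq S.isCuspCocycle
  exact ⟨u, fun γ ↦ by rw [hu, ι_coe]⟩

/-! ### The invariant function `Φ = U - re E_u` -/

/-- `Φ = U - re E_u`. [folklore] -/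
def Φ (u : CuspForm (Gamma0 N) 2) (τ : ℍ) : ℂ :=
  ((S.U τ : ℝ) : ℂ) - (((eichlerIntegral u τ).re : ℝ) : ℂ)

/-- `Φ' = U' - (re E_u)'`. [folklore] -/
def Φ' (u : CuspForm (Gamma0 N) 2) (z : ℂ) : ℂ →L[ℝ] ℂ :=
  Complex.ofRealCLM.comp (S.U' z) - reEichlerDeriv u z

/-- **`Φ` is real-`C¹`** with derivative `Φ'`. [folklore] -/
theorem hasFDerivAt_Φ [NeZero N] (u : CuspForm (Gamma0 N) 2) {z : ℂ} (hz : 0 < z.im) :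
    HasFDerivAt (S.Φ u ∘ UpperHalfPlane.ofComplex) (S.Φ' u z) z := by
  have h1 := Complex.ofRealCLM.hasFDerivAt.comp z
    (DualForm.hasFDerivAt_dualPotential S.hξ S.hκ S.hκ1 S.hw S.hε S.hε' UpperHalfPlane.I hz)
  have h2 := hasFDerivAt_re_eichlerIntegral u hz
  exact h1.sub h2

/-- `Φ'` is continuous on the upper half-plane. [folklore] -/
theorem continuousOn_Φ' [NeZero N] (u : CuspForm (Gamma0 N) 2) : ContinuousOn (S.Φ' u) {z : ℂ | 0 < z.im} :=
  (continuousOn_const.clm_comp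
    (DualForm.continuousOn_dualPotentialDeriv S.hξ S.hκ S.hκ1 S.hw S.hε S.hε' UpperHalfPlane.I)).sub
    (continuousOn_reEichlerDeriv u)

/-- **`Φ` is `Γ₀(N)`-invariant** when `re {∞, γ∞}_u = p(γ)`: `U(γτ) = U(τ) + p(γ)` and
`E_u(γτ) = E_u(τ) + {∞, γ∞}_u`. [folklore] -/
theorem Φ_smul [NeZero N] {u : CuspForm (Gamma0 N) 2} (hu : ∀ γ : Gamma0 N, (cuspSymbol u γ).re = S.p γ)
    (γ : SL(2, ℤ)) (hγ : γ ∈ Gamma0 N) (τ : ℍ) : S.Φ u (γ • τ) = S.Φ u τ := by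
  have h1 := S.U_smul ⟨γ, hγ⟩ τ
  have h2 := eichlerIntegral_smul_sub_holds u ⟨γ, hγ⟩ τ
  rw [sub_eq_iff_eq_add] at h2
  simp only [Φ]
  rw [show ((⟨γ, hγ⟩ : Gamma0 N) : SL(2, ℤ)) = γ from rfl] at h1 h2
  rw [h1, h2, Complex.add_re, hu]
  push_cast
  ring

end Setup

/-! ### Bounds: `Φ` is bounded and `‖Φ'(z)‖ ≤ M'/im z` -/

section Bounds

variable {N : ℕ}

/-- **A uniform bound for the vertical-ray integral of a cuspidal `q`-series above height `1`**:
`‖V_φ(τ)‖ ≤ C` for `im τ ≥ 1` (`V_φ(τ) = ∑ cₙ (h/n) q_h(τ)ⁿ`, `|q_h(τ)| ≤ e^{-2π/h}`). [folklore] -/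
theorem _root_.Literature.NumberTheory.EllipticCurves.ModularForms.IsCuspFunction.exists_bound_verticalIntegral
    {h : ℝ} {φ : ℍ → ℂ} (hφ : IsCuspFunction h φ) :
    ∃ C : ℝ, ∀ τ : ℍ, 1 ≤ τ.im → ‖verticalIntegral φ τ‖ ≤ C := by
  have hh := hφ.pos
  set ρ₁ : ℝ := Real.exp (-2 * π / h) with hρ₁
  have hρ₁0 : 0 ≤ ρ₁ := (Real.exp_pos _).le
  have hρ₁1 : ρ₁ < 1 := by
    rw [hρ₁, Real.exp_lt_one_iff]
    have : 0 < 2 * π / h := by positivity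
    have e : -2 * π / h = -(2 * π / h) := by ring
    rw [e]; linarith
  have hS := hφ.summable_norm_coeff_mul_pow hρ₁0 hρ₁1
  refine ⟨h * ∑' n : ℕ, ‖(UpperHalfPlane.qExpansion h φ).coeff n‖ * ρ₁ ^ n, fun τ hτ ↦ ?_⟩
  have hq : ‖Function.Periodic.qParam h τ‖ ≤ ρ₁ := by
    rw [Function.Periodic.norm_qParam, hρ₁, Real.exp_le_exp]
    have h1 : -2 * π * τ.im / h = -((2 * π / h) * τ.im) := by ring
    have h2 : -2 * π / h = -(2 * π / h) := by ring
    rw [UpperHalfPlane.coe_im, h1, h2, neg_le_neg_iff]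
    have : 0 < 2 * π / h := by positivity
    nlinarith
  rw [← tsum_mul_left]
  refine (hφ.hasSum_verticalIntegral τ).norm_le_of_bounded ((hS.mul_left h).hasSum) fun n ↦ ?_
  rcases Nat.eq_zero_or_pos n with rfl | hn
  · simp [hφ.coeff_zero]
  · rw [norm_mul, norm_mul, norm_pow]
    have hhn : ‖((h : ℂ) / (n : ℂ))‖ ≤ h := by
      rw [norm_div, Complex.norm_real, Complex.norm_natCast, Real.norm_of_nonneg hh.le]
      exact div_le_self hh.le (by exact_mod_cast hn)
    calc ‖(UpperHalfPlane.qExpansion h φ).coeff n‖ * ‖((h : ℂ) / (n : ℂ))‖ * ‖Function.Periodic.qParam h τ‖ ^ n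
        ≤ ‖(UpperHalfPlane.qExpansion h φ).coeff n‖ * h * ρ₁ ^ n := by
          gcongr
      _ = h * (‖(UpperHalfPlane.qExpansion h φ).coeff n‖ * ρ₁ ^ n) := by ring

/-- **The norm of a real-linear form composed with a complex multiplication**:
`‖L ∘ (h ↦ c h)‖ = |c| ‖L‖`. [folklore] -/
theorem opNorm_comp_toSpanSingleton (L : ℂ →L[ℝ] ℂ) (c : ℂ) :
    ‖L.comp ((ContinuousLinearMap.toSpanSingleton ℂ c).restrictScalars ℝ)‖ = ‖c‖ * ‖L‖ := by
  have hle : ∀ (L : ℂ →L[ℝ] ℂ) (c : ℂ),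
      ‖L.comp ((ContinuousLinearMap.toSpanSingleton ℂ c).restrictScalars ℝ)‖ ≤ ‖c‖ * ‖L‖ := by
    intro L c
    refine ContinuousLinearMap.opNorm_le_bound _ (by positivity) fun h ↦ ?_
    rw [ContinuousLinearMap.comp_apply, ContinuousLinearMap.coe_restrictScalars',
      ContinuousLinearMap.toSpanSingleton_apply]
    calc ‖L (h • c)‖ ≤ ‖L‖ * ‖h • c‖ := L.le_opNorm _
      _ = ‖c‖ * ‖L‖ * ‖h‖ := by rw [norm_smul]; ring
  refine le_antisymm (hle L c) ?_
  by_cases hc : c = 0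
  · simp [hc]
  · -- `L = (L ∘ c) ∘ c⁻¹`
    have e : L = (L.comp ((ContinuousLinearMap.toSpanSingleton ℂ c).restrictScalars ℝ)).comp
        ((ContinuousLinearMap.toSpanSingleton ℂ c⁻¹).restrictScalars ℝ) := by
      ext h; simp [ContinuousLinearMap.toSpanSingleton_apply, hc]
    have h := hle (L.comp ((ContinuousLinearMap.toSpanSingleton ℂ c).restrictScalars ℝ)) c⁻¹
    rw [← e, norm_inv] at h
    have hc' : 0 < ‖c‖ := norm_pos_iff.mpr hc
    calc ‖c‖ * ‖L‖ ≤ ‖c‖ * (‖c‖⁻¹ * ‖L.comp ((ContinuousLinearMap.toSpanSingleton ℂ c).restrictScalars ℝ)‖) := by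
          gcongr
      _ = ‖L.comp ((ContinuousLinearMap.toSpanSingleton ℂ c).restrictScalars ℝ)‖ := by
          field_simp

/-- **The weighted derivative norm of an invariant function is invariant**: if `Φ ∘ ofComplex` has
derivative `Φ'` on the upper half-plane and `Φ(γτ) = Φ(τ)`, then `im(γz) ‖Φ'(γz)‖ = im z ‖Φ'(z)‖`
(chain rule: `Φ'(z) = Φ'(γz) ∘ (h ↦ γ'(z) h)` and `im(γz) = |γ'(z)| im z`). [folklore] -/
theorem im_mul_norm_fderiv_smul {Φ : ℍ → ℂ} {Φ' : ℂ → (ℂ →L[ℝ] ℂ)}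
    (hΦ : ∀ z : ℂ, 0 < z.im → HasFDerivAt (Φ ∘ UpperHalfPlane.ofComplex) (Φ' z) z)
    (γ : SL(2, ℤ)) (hinv : ∀ τ : ℍ, Φ (γ • τ) = Φ τ) {z : ℂ} (hz : 0 < z.im) :
    (moebius γ z).im * ‖Φ' (moebius γ z)‖ = z.im * ‖Φ' z‖ := by
  have hγz := moebius_im_pos γ hz
  -- chain rule for `Φ ∘ γ = Φ`
  set c : ℂ := 1 / (((γ 1 0 : ℤ) : ℂ) * z + ((γ 1 1 : ℤ) : ℂ)) ^ 2 with hc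
  have hm : HasFDerivAt (moebius γ) ((ContinuousLinearMap.toSpanSingleton ℂ c).restrictScalars ℝ) z :=
    (hasDerivAt_moebius γ hz).hasFDerivAt.restrictScalars ℝ
  have h1 : HasFDerivAt ((Φ ∘ UpperHalfPlane.ofComplex) ∘ moebius γ)
      ((Φ' (moebius γ z)).comp ((ContinuousLinearMap.toSpanSingleton ℂ c).restrictScalars ℝ)) z :=
    (hΦ _ hγz).comp z hm
  have h2 : HasFDerivAt ((Φ ∘ UpperHalfPlane.ofComplex) ∘ moebius γ) (Φ' z) z := by
    refine (hΦ z hz).congr_of_eventuallyEq ?_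
    filter_upwards [(Complex.continuous_im.isOpen_preimage _ isOpen_Ioi).mem_nhds hz] with w hw
    simp only [Function.comp_apply]
    rw [← smul_ofComplex γ hw, hinv]
  have heq := h1.unique h2
  rw [← heq, opNorm_comp_toSpanSingleton]
  -- `im(γz) = |c| im z`
  have hden := moebius_denom_ne_zero γ hz
  have him : (moebius γ z).im = ‖c‖ * z.im := by
    have e1 : (moebius γ z).im = ((γ • UpperHalfPlane.ofComplex z : ℍ)).im := by
      rw [← coe_smul_ofComplex γ hz]; rfl
    have e2 : (UpperHalfPlane.ofComplex z).im = z.im := by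
      rw [UpperHalfPlane.ofComplex_apply_of_im_pos hz]; rfl
    rw [e1, ModularGroup.im_smul_eq_div_normSq, denom_ofComplex γ hz, e2, hc, norm_div, norm_one, norm_pow,
      Complex.normSq_eq_norm_sq]
    field_simp
  rw [him]; ring

variable (S : Setup N)

/-- `U` is continuous on `ℍ`. [folklore] -/
theorem Setup.continuous_U : Continuous S.U := by
  have hc : ContinuousOn (S.U ∘ UpperHalfPlane.ofComplex) {z : ℂ | 0 < z.im} := fun z hz ↦
    (DualForm.hasFDerivAt_dualPotential S.hξ S.hκ S.hκ1 S.hw S.hε S.hε' UpperHalfPlane.I hz).continuousAt.continuousWithinAt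
  have h : S.U = (S.U ∘ UpperHalfPlane.ofComplex) ∘ ((↑) : ℍ → ℂ) := by
    funext τ; simp [UpperHalfPlane.ofComplex_apply]
  rw [h]
  exact hc.comp_continuous UpperHalfPlane.continuous_coe fun τ ↦ τ.im_pos

/-- `E_u` is continuous on `ℍ`. [folklore] -/
theorem continuous_eichlerIntegral [NeZero N] (u : CuspForm (Gamma0 N) 2) : Continuous (eichlerIntegral u) := by
  have hc : ContinuousOn (fun z : ℂ ↦ eichlerIntegral u (UpperHalfPlane.ofComplex z)) {z : ℂ | 0 < z.im} :=
    fun z hz ↦ (hasDerivAt_eichlerIntegral u hz).continuousAt.continuousWithinAt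
  have h : eichlerIntegral u = (fun z : ℂ ↦ eichlerIntegral u (UpperHalfPlane.ofComplex z)) ∘ ((↑) : ℍ → ℂ) := by
    funext τ; simp [UpperHalfPlane.ofComplex_apply]
  rw [h]
  exact hc.comp_continuous UpperHalfPlane.continuous_coe fun τ ↦ τ.im_pos

/-- `Φ` is continuous on `ℍ`. [folklore] -/
theorem Setup.continuous_Φ [NeZero N] (u : CuspForm (Gamma0 N) 2) : Continuous (S.Φ u) := by
  unfold Setup.Φ
  exact (Complex.continuous_ofReal.comp S.continuous_U).sub
    (Complex.continuous_ofReal.comp (Complex.continuous_re.comp (continuous_eichlerIntegral u)))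

/-- **`Φ ∘ g` is bounded at `i∞`** for every `g ∈ SL(2, ℤ)`: above the height `Y₀` the
potential `U` is constant on the horoball `g · {im > Y₀}`, and
`E_u(gτ) = C_g + V_{u∣g}(τ)` with `V_{u∣g}` bounded above height `1`. [folklore] -/
theorem Setup.isBoundedAtImInfty_Φ [NeZero N] (u : CuspForm (Gamma0 N) 2) (g : SL(2, ℤ)) :
    UpperHalfPlane.IsBoundedAtImInfty fun τ : ℍ ↦ S.Φ u (g • τ) := by
  obtain ⟨C, hC⟩ := (isCuspFunction_slash u g).exists_bound_verticalIntegral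
  rw [UpperHalfPlane.isBoundedAtImInfty_iff]
  set Cg : ℂ := verticalIntegral ⇑u (g • S.τY) - verticalIntegral (⇑u ∣[(2 : ℤ)] g) S.τY with hCg
  refine ⟨|S.U (g • S.τY)| + (‖Cg‖ + C), S.Y₀ + 1, fun τ hτ ↦ ?_⟩
  have h1 : S.U (g • τ) = S.U (g • S.τY) := by
    refine S.U_eq_of_height g ?_ ?_
    · rw [inv_smul_smul]; linarith
    · rw [inv_smul_smul, Setup.τY_im]; linarith
  have h2 : eichlerIntegral u (g • τ) = Cg + verticalIntegral (⇑u ∣[(2 : ℤ)] g) τ := by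
    have := verticalIntegral_smul_sub_eq g (isCuspFunction_one u) (isCuspFunction_slash u g) τ S.τY
    rw [hCg, ← this]
    show verticalIntegral ⇑u (g • τ) = _
    ring
  have h3 : ‖verticalIntegral (⇑u ∣[(2 : ℤ)] g) τ‖ ≤ C := hC τ (by linarith [S.hY₀])
  simp only [Setup.Φ, h1, h2]
  refine (norm_sub_le _ _).trans (add_le_add ?_ ?_)
  · rw [Complex.norm_real, Real.norm_eq_abs]
  · rw [Complex.norm_real, Real.norm_eq_abs]
    refine (Complex.abs_re_le_norm _).trans ((norm_add_le _ _).trans ?_)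
    gcongr

/-- **`Φ` is bounded on `ℍ`** (Mathlib's `ModularGroup.exists_bound_of_subgroup_invariant`:
continuous, invariant, bounded at every cusp). [folklore] -/
theorem Setup.exists_bound_Φ [NeZero N] {u : CuspForm (Gamma0 N) 2} (hu : ∀ γ : Gamma0 N, (cuspSymbol u γ).re = S.p γ) :
    ∃ M : ℝ, ∀ τ : ℍ, ‖S.Φ u τ‖ ≤ M := by
  refine ModularGroup.exists_bound_of_subgroup_invariant (S.continuous_Φ u) (S.isBoundedAtImInfty_Φ u)
    (Γ := (Gamma0 N : Subgroup (GL (Fin 2) ℝ))) fun g hg τ ↦ ?_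
  obtain ⟨γ, hγ, rfl⟩ := Subgroup.mem_map.mp hg
  exact S.Φ_smul hu γ hγ τ

/-- On the horoballs `g · {im > Y₀}` the derivative `U'` vanishes (`U` is constant there). [folklore] -/
theorem Setup.U'_eq_zero (g : SL(2, ℤ)) {z : ℂ} (hz : 0 < z.im)
    (hh : S.Y₀ < (g⁻¹ • UpperHalfPlane.ofComplex z).im) : S.U' z = 0 := by
  have h1 : HasFDerivAt (S.U ∘ UpperHalfPlane.ofComplex) (S.U' z) z :=
    DualForm.hasFDerivAt_dualPotential S.hξ S.hκ S.hκ1 S.hw S.hε S.hε' UpperHalfPlane.I hz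
  -- `U ∘ ofComplex` is constant near `z`
  have hopen : IsOpen ({w : ℂ | 0 < w.im} ∩
      (fun w : ℂ ↦ ((g⁻¹ • UpperHalfPlane.ofComplex w : ℍ)).im) ⁻¹' Ioi S.Y₀) := by
    have hc : ContinuousOn (fun w : ℂ ↦ ((g⁻¹ • UpperHalfPlane.ofComplex w : ℍ)).im) {w : ℂ | 0 < w.im} := by
      refine UpperHalfPlane.continuous_im.comp_continuousOn ((continuous_sl2z_smul g⁻¹).comp_continuousOn ?_)
      exact DualForm.continuousOn_ofComplex_comp continuousOn_id fun w hw ↦ hw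
    exact hc.isOpen_inter_preimage (Complex.continuous_im.isOpen_preimage _ isOpen_Ioi) isOpen_Ioi
  have h2 : HasFDerivAt (S.U ∘ UpperHalfPlane.ofComplex) (0 : ℂ →L[ℝ] ℝ) z := by
    refine (hasFDerivAt_const (S.U (g • S.τY)) z).congr_of_eventuallyEq ?_
    filter_upwards [hopen.mem_nhds ⟨hz, hh⟩] with w hw
    obtain ⟨hw, hw'⟩ := hw
    simp only [Function.comp_apply]
    refine S.U_eq_of_height g hw' ?_
    rw [inv_smul_smul, Setup.τY_im]; linarith
  exact h1.unique h2

/-- **`im τ ‖Φ'(gτ)‖` is bounded at `i∞`** for every `g`: there `U' = 0` and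
`‖(re E_u)'‖ ≤ 2π|u|`, `im · |u| ≤ C` (`CuspFormClass.exists_bound`). [folklore] -/
theorem Setup.isBoundedAtImInfty_G [NeZero N] (u : CuspForm (Gamma0 N) 2) (g : SL(2, ℤ)) :
    UpperHalfPlane.IsBoundedAtImInfty fun τ : ℍ ↦ ((g • τ : ℍ)).im * ‖S.Φ' u ((g • τ : ℍ) : ℂ)‖ := by
  obtain ⟨C, hC⟩ := CuspFormClass.exists_bound u
  rw [UpperHalfPlane.isBoundedAtImInfty_iff]
  refine ⟨2 * π * C, S.Y₀ + 1, fun τ hτ ↦ ?_⟩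
  have hz : 0 < (((g • τ : ℍ)) : ℂ).im := (g • τ).im_pos
  have hU' : S.U' ((g • τ : ℍ) : ℂ) = 0 := by
    refine S.U'_eq_zero g hz ?_
    rw [UpperHalfPlane.ofComplex_apply, inv_smul_smul]; linarith
  have hΦ' : S.Φ' u ((g • τ : ℍ) : ℂ) = -reEichlerDeriv u ((g • τ : ℍ) : ℂ) := by
    rw [Setup.Φ', hU']; simp
  rw [Real.norm_eq_abs, abs_of_nonneg (by positivity), hΦ', norm_neg]
  have h1 := norm_reEichlerDeriv_le u ((g • τ : ℍ) : ℂ)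
  rw [UpperHalfPlane.ofComplex_apply] at h1
  have h2 := hC (g • τ)
  have him := (g • τ).im_pos
  have h3 : (g • τ).im * ‖u (g • τ)‖ ≤ C := by
    rw [show ((2 : ℤ) / 2 : ℝ) = 1 by norm_num, Real.rpow_one] at h2
    rwa [le_div_iff₀ him, mul_comm] at h2
  calc (g • τ).im * ‖reEichlerDeriv u ((g • τ : ℍ) : ℂ)‖
      ≤ (g • τ).im * (2 * π * ‖u (g • τ)‖) := by gcongr
    _ = 2 * π * ((g • τ).im * ‖u (g • τ)‖) := by ring
    _ ≤ 2 * π * C := by gcongr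

/-- **`‖Φ'(z)‖ ≤ M'/im z` on `ℍ`**: `τ ↦ im τ ‖Φ'(τ)‖` is continuous, `Γ₀(N)`-invariant
(`im_mul_norm_fderiv_smul`) and bounded at every cusp. [folklore] -/
theorem Setup.exists_bound_Φ' [NeZero N] {u : CuspForm (Gamma0 N) 2} (hu : ∀ γ : Gamma0 N, (cuspSymbol u γ).re = S.p γ) :
    ∃ M' : ℝ, ∀ z : ℂ, 0 < z.im → ‖S.Φ' u z‖ ≤ M' / z.im := by
  set G : ℍ → ℝ := fun τ ↦ τ.im * ‖S.Φ' u (τ : ℂ)‖ with hG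
  have hcont : Continuous G := by
    refine UpperHalfPlane.continuous_im.mul (continuous_norm.comp ?_)
    exact (S.continuousOn_Φ' u).comp_continuous UpperHalfPlane.continuous_coe fun τ ↦ τ.im_pos
  have hinf : ∀ g : SL(2, ℤ), UpperHalfPlane.IsBoundedAtImInfty fun τ : ℍ ↦ G (g • τ) :=
    fun g ↦ S.isBoundedAtImInfty_G u g
  have hinv : ∀ g ∈ (Gamma0 N : Subgroup (GL (Fin 2) ℝ)), ∀ τ : ℍ, G (g • τ) = G τ := by
    intro g hg τ
    obtain ⟨γ, hγ, rfl⟩ := Subgroup.mem_map.mp hg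
    show G (γ • τ) = G τ
    simp only [hG]
    have h := im_mul_norm_fderiv_smul (fun z hz ↦ S.hasFDerivAt_Φ u hz) γ (S.Φ_smul hu γ hγ) τ.im_pos
    rw [← coe_smul_ofComplex γ τ.im_pos, UpperHalfPlane.ofComplex_apply] at h
    rw [UpperHalfPlane.coe_im, UpperHalfPlane.coe_im] at h
    exact h
  obtain ⟨M', hM'⟩ := ModularGroup.exists_bound_of_subgroup_invariant hcont hinf
    (Γ := (Gamma0 N : Subgroup (GL (Fin 2) ℝ))) hinv
  refine ⟨M', fun z hz ↦ ?_⟩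
  have h := hM' (UpperHalfPlane.ofComplex z)
  simp only [hG, Real.norm_eq_abs] at h
  rw [abs_of_nonneg (by positivity), UpperHalfPlane.ofComplex_apply_of_im_pos hz] at h
  rw [le_div_iff₀ hz, mul_comm]
  exact h

end Bounds

/-! ### The pairing: `⟨u, f⟩ = i · sign(ℓ) · {∞, δ₀∞}_f / (4π²)` -/

section Pairing

variable {N : ℕ} (S : Setup N)

/-- The sign of `ℓ = log κ` as a complex unit. [folklore] -/
def Setup.sgn : ℂ := if 0 < Real.log S.κ then (1 : ℂ) else -1

/-- `sgn² = 1`. [folklore] -/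
theorem Setup.sgn_mul_sgn : S.sgn * S.sgn = 1 := by
  unfold Setup.sgn; split_ifs <;> norm_num

/-- **The cut-off `∂B₀/∂z̄` against `y² f`**: `v(σ) = (im σ)² f(σ) 𝟙_{[0,|ℓ|)}(log|w σ|) · i b'(arg w σ) \overline{ζ'(σ)}`,
the function on `ℍ` whose `Γ₀(N)`-periodisation is `2 y² f ∂U/∂z̄` (`DualForm.tsum_periodisation_eq`). [folklore] -/
def Setup.v (f : CuspForm (Gamma0 N) 2) (σ : ℍ) : ℂ :=
  (((σ.im : ℝ) : ℂ)) ^ 2 * (f σ *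
    (Ico (0 : ℝ) |Real.log S.κ|).indicator (fun _ ↦ (1 : ℂ)) (Real.log ‖((σ : ℂ) - S.ξ₁) / ((σ : ℂ) - S.ξ₂)‖) *
    (I * ((deriv (fun θ : ℝ ↦ Real.smoothTransition ((θ - (π / 2 - S.ε)) / (2 * S.ε)))
      (Complex.arg (((σ : ℂ) - S.ξ₁) / ((σ : ℂ) - S.ξ₂))) : ℝ) : ℂ) * conj (1 / ((σ : ℂ) - S.ξ₁) - 1 / ((σ : ℂ) - S.ξ₂))))

/-- The `U'`-part of the pairing integrand: `C(σ) = (im σ)² f(σ) (U'(σ)1 + i U'(σ)i)`. [folklore] -/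
def Setup.Cpart (f : CuspForm (Gamma0 N) 2) (σ : ℍ) : ℂ :=
  (((σ.im : ℝ) : ℂ)) ^ 2 * f σ * (((S.U' (σ : ℂ) 1 : ℝ) : ℂ) + I * ((S.U' (σ : ℂ) I : ℝ) : ℂ))

/-- **Weight-`2` transformation of `y² f`**: `(im γσ)² f(γσ) = (im σ)² f(σ) \overline{γ'(σ)}`,
`γ'(σ) = (cσ + d)⁻²`, for `γ ∈ Γ₀(N)`. [folklore] -/
theorem im_sq_mul_apply_smul (f : CuspForm (Gamma0 N) 2) (γ : Gamma0 N) (σ : ℍ) :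
    ((((((γ : SL(2, ℤ)) • σ : ℍ)).im : ℝ) : ℂ)) ^ 2 * f (((γ : SL(2, ℤ))) • σ) =
      (((σ.im : ℝ) : ℂ)) ^ 2 * f σ *
        conj (1 / ((((γ : SL(2, ℤ)) 1 0 : ℤ) : ℂ) * (σ : ℂ) + (((γ : SL(2, ℤ)) 1 1 : ℤ) : ℂ)) ^ 2) := by
  set cd : ℂ := (((γ : SL(2, ℤ)) 1 0 : ℤ) : ℂ) * (σ : ℂ) + (((γ : SL(2, ℤ)) 1 1 : ℤ) : ℂ) with hcd
  have hden : UpperHalfPlane.denom (γ : SL(2, ℤ)) σ = cd := by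
    rw [ModularGroup.denom_apply, hcd]
  have hcd0 : cd ≠ 0 := by rw [← hden]; exact UpperHalfPlane.denom_ne_zero _ _
  -- `f(γσ) = (cσ+d)² f(σ)`
  have hf : f (((γ : SL(2, ℤ))) • σ) = cd ^ 2 * f σ := by
    have h := SlashInvariantForm.slash_action_eqn_SL'' f (γ := (γ : SL(2, ℤ))) γ.2 σ
    rw [hden] at h
    exact_mod_cast h
  -- `im γσ = im σ / |cσ+d|²`
  have him : (((γ : SL(2, ℤ))) • σ).im = σ.im / Complex.normSq cd := by
    rw [ModularGroup.im_smul_eq_div_normSq, hden]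
  rw [hf, him]
  have hn : ((Complex.normSq cd : ℝ) : ℂ) = cd * conj cd := (Complex.mul_conj cd).symm
  have hcc : conj cd ≠ 0 := (map_ne_zero _).mpr hcd0
  push_cast
  rw [hn, map_div₀, map_one, map_pow]
  field_simp

/-- `v(γσ) = (im σ)² f(σ) · k_γ(σ)` with `k_γ` the summand of `DualForm.tsum_periodisation_eq`. [folklore] -/
theorem Setup.v_smul (f : CuspForm (Gamma0 N) 2) (γ : Gamma0 N) (σ : ℍ) :
    S.v f (((γ : SL(2, ℤ))) • σ) = (((σ.im : ℝ) : ℂ)) ^ 2 * f σ *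
      ((Ico (0 : ℝ) |Real.log S.κ|).indicator (fun _ ↦ (1 : ℂ))
          (Real.log ‖(moebius (γ : SL(2, ℤ)) σ - S.ξ₁) / (moebius (γ : SL(2, ℤ)) σ - S.ξ₂)‖) *
        (I * ((deriv (fun θ : ℝ ↦ Real.smoothTransition ((θ - (π / 2 - S.ε)) / (2 * S.ε)))
          (Complex.arg ((moebius (γ : SL(2, ℤ)) σ - S.ξ₁) / (moebius (γ : SL(2, ℤ)) σ - S.ξ₂))) : ℝ) : ℂ) *
          conj (DualForm.stripDeriv S.ξ₁ S.ξ₂ (γ : SL(2, ℤ)) σ))) := by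
  have hcoe : ((((γ : SL(2, ℤ)) • σ : ℍ)) : ℂ) = moebius (γ : SL(2, ℤ)) σ := DualForm.coe_smul_eq_moebius _ _
  unfold Setup.v DualForm.stripDeriv
  rw [hcoe, map_mul]
  have h := im_sq_mul_apply_smul f γ σ
  -- rearrange
  calc ((((((γ : SL(2, ℤ)) • σ : ℍ)).im : ℝ) : ℂ)) ^ 2 * (f (((γ : SL(2, ℤ))) • σ) *
        (Ico (0 : ℝ) |Real.log S.κ|).indicator (fun _ ↦ (1 : ℂ))
          (Real.log ‖(moebius (γ : SL(2, ℤ)) σ - S.ξ₁) / (moebius (γ : SL(2, ℤ)) σ - S.ξ₂)‖) *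
        (I * ((deriv (fun θ : ℝ ↦ Real.smoothTransition ((θ - (π / 2 - S.ε)) / (2 * S.ε)))
          (Complex.arg ((moebius (γ : SL(2, ℤ)) σ - S.ξ₁) / (moebius (γ : SL(2, ℤ)) σ - S.ξ₂))) : ℝ) : ℂ) *
          conj (1 / (moebius (γ : SL(2, ℤ)) σ - S.ξ₁) - 1 / (moebius (γ : SL(2, ℤ)) σ - S.ξ₂))))
      = (((((((γ : SL(2, ℤ)) • σ : ℍ)).im : ℝ) : ℂ)) ^ 2 * f (((γ : SL(2, ℤ))) • σ)) *
        ((Ico (0 : ℝ) |Real.log S.κ|).indicator (fun _ ↦ (1 : ℂ))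
          (Real.log ‖(moebius (γ : SL(2, ℤ)) σ - S.ξ₁) / (moebius (γ : SL(2, ℤ)) σ - S.ξ₂)‖) *
        (I * ((deriv (fun θ : ℝ ↦ Real.smoothTransition ((θ - (π / 2 - S.ε)) / (2 * S.ε)))
          (Complex.arg ((moebius (γ : SL(2, ℤ)) σ - S.ξ₁) / (moebius (γ : SL(2, ℤ)) σ - S.ξ₂))) : ℝ) : ℂ) *
          conj (1 / (moebius (γ : SL(2, ℤ)) σ - S.ξ₁) - 1 / (moebius (γ : SL(2, ℤ)) σ - S.ξ₂)))) := by ring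
    _ = _ := by rw [h]; ring

/-- **`∑_{γ ∈ Γ₀(N)} v(γσ) = 2 C(σ)`**: the periodisation of `v` is `2 y² f ∂U/∂z̄`. [folklore] -/
theorem Setup.tsum_v_smul (f : CuspForm (Gamma0 N) 2) (σ : ℍ) :
    ∑' γ : Gamma0 N, S.v f (((γ : SL(2, ℤ))) • σ) = 2 * S.Cpart f σ := by
  simp_rw [S.v_smul f]
  rw [tsum_mul_left, DualForm.tsum_periodisation_eq S.hξ S.hκ S.hκ1 S.hw S.hε S.hε' UpperHalfPlane.I σ.im_pos]
  unfold Setup.Cpart Setup.U'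
  ring

/-- **`∫_ℍ v dμ = sign(ℓ) {∞, δ₀∞}_f / (2π)`** (transfer to `dx dy` on the upper half-plane,
`FdCoord.setIntegral_eq_setIntegral_image`, and the band integral `HypStrip.setIntegral_uhp_band_eq`). [folklore] -/
theorem Setup.integral_v [NeZero N] (f : CuspForm (Gamma0 N) 2) :
    ∫ σ, S.v f σ = S.sgn * cuspSymbol f S.δ₀ / (2 * π) := by
  rw [← setIntegral_univ, FdCoord.setIntegral_eq_setIntegral_image _ MeasurableSet.univ, Set.image_univ,
    UpperHalfPlane.range_coe]
  have hδ : (S.δ₀ : SL(2, ℤ)) ∈ Gamma0 N := S.δ₀.2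
  have h := HypStrip.setIntegral_uhp_band_eq f hδ S.hξ S.hκ S.hκ1 S.hw S.hε S.hε'
  rw [Setup.sgn, ← h]
  refine setIntegral_congr_fun (measurableSet_lt measurable_const Complex.measurable_im) fun z hz ↦ ?_
  have hz' : 0 < z.im := hz
  have e1 : ((UpperHalfPlane.ofComplex z : ℍ) : ℂ) = z := by
    rw [UpperHalfPlane.ofComplex_apply_of_im_pos hz']
  have e2 : (UpperHalfPlane.ofComplex z).im = z.im := by
    rw [UpperHalfPlane.ofComplex_apply_of_im_pos hz']; rfl
  simp only [Setup.v, e1, e2]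
  have hscal : ((1 / z.im ^ 2 : ℝ) : ℂ) * (((z.im : ℝ) : ℂ)) ^ 2 = 1 := by
    have hz0 : (z.im : ℂ) ≠ 0 := Complex.ofReal_ne_zero.mpr hz'.ne'
    push_cast
    field_simp
  rw [← mul_assoc, hscal, one_mul]

/-- `v` is measurable. [folklore] -/
theorem Setup.measurable_v (f : CuspForm (Gamma0 N) 2) : Measurable (S.v f) := by
  have hw : Measurable fun σ : ℍ ↦ ((σ : ℂ) - S.ξ₁) / ((σ : ℂ) - S.ξ₂) :=
    (UpperHalfPlane.continuous_coe.sub continuous_const).measurable.div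
      (UpperHalfPlane.continuous_coe.sub continuous_const).measurable
  unfold Setup.v
  refine ((Complex.continuous_ofReal.comp UpperHalfPlane.continuous_im).measurable.pow_const 2).mul
    ((((ModularFormClass.holo f).continuous.measurable.mul ?_)).mul ?_)
  · exact (measurable_const.indicator measurableSet_Ico).comp (Real.measurable_log.comp hw.norm)
  · refine (measurable_const.mul (Complex.measurable_ofReal.comp ?_)).mul ?_
    · exact ((HypStrip.contDiff_band (ε := S.ε)).continuous_deriv le_rfl).measurable.comp
        (Complex.measurable_arg.comp hw)
    · exact (Complex.continuous_conj.measurable.comp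
        (((measurable_const.div (UpperHalfPlane.continuous_coe.sub continuous_const).measurable)).sub
          (measurable_const.div (UpperHalfPlane.continuous_coe.sub continuous_const).measurable)))

/-- The continuous envelope of `v` (without the cut-off). [folklore] -/
theorem Setup.continuous_envelope (f : CuspForm (Gamma0 N) 2) :
    Continuous fun σ : ℍ ↦ (((σ.im : ℝ) : ℂ)) ^ 2 * (f σ *
      (I * ((deriv (fun θ : ℝ ↦ Real.smoothTransition ((θ - (π / 2 - S.ε)) / (2 * S.ε)))
        (Complex.arg (((σ : ℂ) - S.ξ₁) / ((σ : ℂ) - S.ξ₂))) : ℝ) : ℂ) * conj (1 / ((σ : ℂ) - S.ξ₁) - 1 / ((σ : ℂ) - S.ξ₂)))) := by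
  have h1 : ∀ σ : ℍ, (σ : ℂ) - S.ξ₁ ≠ 0 := fun σ ↦ HypStrip.sub_ofReal_ne_zero σ.im_pos _
  have h2 : ∀ σ : ℍ, (σ : ℂ) - S.ξ₂ ≠ 0 := fun σ ↦ HypStrip.sub_ofReal_ne_zero σ.im_pos _
  have hw : Continuous fun σ : ℍ ↦ ((σ : ℂ) - S.ξ₁) / ((σ : ℂ) - S.ξ₂) :=
    (UpperHalfPlane.continuous_coe.sub continuous_const).div (UpperHalfPlane.continuous_coe.sub continuous_const) h2
  have harg : Continuous fun σ : ℍ ↦ Complex.arg (((σ : ℂ) - S.ξ₁) / ((σ : ℂ) - S.ξ₂)) := by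
    refine continuous_iff_continuousAt.mpr fun σ ↦ ?_
    exact ContinuousAt.comp_of_eq (Complex.continuousAt_arg (HypStrip.w_mem_slitPlane S.hξ σ.im_pos))
      hw.continuousAt rfl
  have hb : Continuous (deriv (fun θ : ℝ ↦ Real.smoothTransition ((θ - (π / 2 - S.ε)) / (2 * S.ε)))) :=
    (HypStrip.contDiff_band (ε := S.ε)).continuous_deriv le_rfl
  have hζ : Continuous fun σ : ℍ ↦ conj (1 / ((σ : ℂ) - S.ξ₁) - 1 / ((σ : ℂ) - S.ξ₂)) :=
    Complex.continuous_conj.comp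
      ((continuous_const.div (UpperHalfPlane.continuous_coe.sub continuous_const) h1).sub
        (continuous_const.div (UpperHalfPlane.continuous_coe.sub continuous_const) h2))
  exact ((Complex.continuous_ofReal.comp UpperHalfPlane.continuous_im).pow 2).mul
    ((ModularFormClass.holo f).continuous.mul
      ((continuous_const.mul (Complex.continuous_ofReal.comp (hb.comp harg))).mul hζ))

/-- **`v` is integrable** for `dμ`: it is dominated by its continuous envelope and vanishes off the
compact period box. [folklore] -/
theorem Setup.integrable_v (f : CuspForm (Gamma0 N) 2) : Integrable (S.v f) := by
  -- the compact support
  set K₀ := (fun ζ : ℂ ↦ UpperHalfPlane.ofComplex ((S.ξ₂ * Complex.exp ζ - S.ξ₁) / (Complex.exp ζ - 1))) ''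
      ((Icc (0 : ℝ) |Real.log S.κ|) ×ℂ (Icc (π / 2 - S.ε) (π / 2 + S.ε))) with hK₀
  have hK₀c : IsCompact K₀ := DualForm.isCompact_periodBox S.hξ S.hε' _
  have hzero : ∀ σ ∉ K₀, S.v f σ = 0 := by
    intro σ hσ
    by_cases hρ : Real.log ‖((σ : ℂ) - S.ξ₁) / ((σ : ℂ) - S.ξ₂)‖ ∈ Ico (0 : ℝ) |Real.log S.κ|
    · by_cases hθ : Complex.arg (((σ : ℂ) - S.ξ₁) / ((σ : ℂ) - S.ξ₂)) ∈ Icc (π / 2 - S.ε) (π / 2 + S.ε)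
      · exfalso
        apply hσ
        refine ⟨Complex.log (((σ : ℂ) - S.ξ₁) / ((σ : ℂ) - S.ξ₂)), ⟨?_, ?_⟩, ?_⟩
        · rw [Set.mem_preimage, Complex.log_re]; exact Ico_subset_Icc_self hρ
        · rw [Set.mem_preimage, Complex.log_im]; exact hθ
        · simp only
          rw [HypStrip.zInv_log_w S.hξ σ.im_pos, UpperHalfPlane.ofComplex_apply]
      · simp [Setup.v, HypStrip.deriv_band_eq_zero S.hε hθ]
    · unfold Setup.v
      rw [indicator_of_notMem hρ]; simp
  -- the bound
  obtain ⟨M, hM⟩ := hK₀c.exists_bound_of_continuousOn (S.continuous_envelope f).continuousOn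
  have hbound : ∀ σ, ‖S.v f σ‖ ≤ max M 0 := by
    intro σ
    by_cases hσ : σ ∈ K₀
    · refine le_trans ?_ ((hM σ hσ).trans (le_max_left _ _))
      have hχ : ‖(Ico (0 : ℝ) |Real.log S.κ|).indicator (fun _ ↦ (1 : ℂ))
          (Real.log ‖((σ : ℂ) - S.ξ₁) / ((σ : ℂ) - S.ξ₂)‖)‖ ≤ 1 := by
        by_cases h : Real.log ‖((σ : ℂ) - S.ξ₁) / ((σ : ℂ) - S.ξ₂)‖ ∈ Ico (0 : ℝ) |Real.log S.κ|
        · rw [indicator_of_mem h, norm_one]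
        · rw [indicator_of_notMem h, norm_zero]; exact zero_le_one
      unfold Setup.v
      simp only [norm_mul]
      refine mul_le_mul_of_nonneg_left ?_ (norm_nonneg _)
      set T : ℝ := ‖I‖ * ‖(((deriv (fun θ : ℝ ↦ Real.smoothTransition ((θ - (π / 2 - S.ε)) / (2 * S.ε)))
        (Complex.arg (((σ : ℂ) - S.ξ₁) / ((σ : ℂ) - S.ξ₂))) : ℝ) : ℂ))‖ *
        ‖conj (1 / ((σ : ℂ) - S.ξ₁) - 1 / ((σ : ℂ) - S.ξ₂))‖ with hT
      have hT0 : 0 ≤ T := by positivity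
      calc ‖f σ‖ * ‖(Ico (0 : ℝ) |Real.log S.κ|).indicator (fun _ ↦ (1 : ℂ))
            (Real.log ‖((σ : ℂ) - S.ξ₁) / ((σ : ℂ) - S.ξ₂)‖)‖ * T ≤ ‖f σ‖ * 1 * T := by gcongr
        _ = ‖f σ‖ * T := by ring
    · rw [hzero σ hσ, norm_zero]; exact le_max_right _ _
  have hint : IntegrableOn (S.v f) K₀ :=
    Measure.integrableOn_of_bounded hK₀c.measure_lt_top.ne (S.measurable_v f).aestronglyMeasurable
      (ae_of_all _ fun σ ↦ hbound σ)
  exact hint.integrable_of_forall_notMem_eq_zero hzero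

end Pairing

section Identity

variable {N : ℕ} [NeZero N] (S : Setup N)

/-- Coset representatives of `Γ₀(N)` in `SL(2, ℤ)` lifting `Quotient.out` on `𝒮ℒ/Γ₀(N)`. [folklore] -/
def rep (q : ↥𝒮ℒ ⧸ (Gamma0 N : Subgroup (GL (Fin 2) ℝ)).subgroupOf 𝒮ℒ) : SL(2, ℤ) :=
  (MonoidHom.mem_range.mp (Quotient.out q : ↥𝒮ℒ).2).choose

omit [NeZero N] in
/-- The representatives lift `Quotient.out`. [folklore] -/
theorem rep_spec (q : ↥𝒮ℒ ⧸ (Gamma0 N : Subgroup (GL (Fin 2) ℝ)).subgroupOf 𝒮ℒ) :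
    (Matrix.SpecialLinearGroup.mapGL ℝ (rep q) : GL (Fin 2) ℝ) = ((Quotient.out q : ↥𝒮ℒ) : GL (Fin 2) ℝ) :=
  (MonoidHom.mem_range.mp (Quotient.out q : ↥𝒮ℒ).2).choose_spec

omit [NeZero N] in
/-- The `re E_u`-part of the pairing integrand is `-2πi` times the Petersson integrand:
`(im σ)² f(σ) \overline{2πi u(σ)} = -2πi · \overline{u(σ)} f(σ) (im σ)²`. [folklore] -/
theorem reE_term_eq (u f : CuspForm (Gamma0 N) 2) (σ : ℍ) :
    (((σ.im : ℝ) : ℂ)) ^ 2 * f σ * (reEichlerDeriv u (σ : ℂ) 1 + I * reEichlerDeriv u (σ : ℂ) I) =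
      -(2 * π * I) * UpperHalfPlane.petersson 2 ⇑u ⇑f σ := by
  rw [reEichlerDeriv_dbar, UpperHalfPlane.ofComplex_apply]
  simp only [UpperHalfPlane.petersson, map_mul, Complex.conj_ofReal, Complex.conj_I, zpow_two]
  have : (starRingEnd ℂ) (2 : ℂ) = 2 := map_ofNat _ 2
  rw [this]
  ring

/-- **The Petersson pairing of `u` with every cusp form is a period**:
`⟨u, f⟩ = i · sign(ℓ) · {∞, δ₀∞}_f / (4π²)` for all `f ∈ S₂(Γ₀(N))`, where `u` is the cusp form with
`re {∞, γ∞}_u = p(γ)`. Proof: with `Φ = U - re E_u` (bounded, invariant, real-`C¹` with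
`‖Φ'‖ ≤ M'/y`), Stokes on `Γ₀(N)∖ℍ` gives `∫ y² f ∂Φ/∂z̄ = 0`
(`QuotientStokes.setIntegral_fd_cosetSum_dbar_eq_zero`); the `re E_u`-part of this integral is
`-2πi⟨u, f⟩` (`reE_term_eq`, `peterssonProduct_eq_setIntegral`), and the `U`-part unfolds
(`Unfolding.integral_fd_sum_tsum_smul_eq`, `Setup.tsum_v_smul`) to `∫_ℍ v = sign(ℓ){∞, δ₀∞}_f/(2π)`
(`Setup.integral_v`). This is Farkas–Kra III.1.1 (1.1.1) `∫_{b} ω = ∬ ω ∧ *η_b` for the closed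
geodesic `b` of `δ₀` on `X₀(N)` and `ω = 2πi f dz`. [cite: FarkasKra1992, III.1.1 (1.1.1) with II.3.3] -/
theorem Setup.peterssonProduct_eq {u : CuspForm (Gamma0 N) 2} (hu : ∀ γ : Gamma0 N, (cuspSymbol u γ).re = S.p γ)
    (f : CuspForm (Gamma0 N) 2) :
    peterssonProduct (Gamma0 N) 2 u f = I * S.sgn * cuspSymbol f S.δ₀ / (4 * π ^ 2) := by
  haveI : Fintype (↥𝒮ℒ ⧸ (Gamma0 N : Subgroup (GL (Fin 2) ℝ)).subgroupOf 𝒮ℒ) := Fintype.ofFinite _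
  obtain ⟨M, hM⟩ := S.exists_bound_Φ hu
  obtain ⟨M', hM'⟩ := S.exists_bound_Φ' hu
  -- (A) Stokes: the `Φ`-part integrates to zero
  have hA := QuotientStokes.setIntegral_fd_cosetSum_dbar_eq_zero rep rep_spec f
    (fun z hz ↦ S.hasFDerivAt_Φ u hz) (S.continuousOn_Φ' u) (fun γ hγ τ ↦ S.Φ_smul hu γ hγ τ) hM hM'
  -- the three integrands
  set Afun : ℍ → ℂ := fun τ ↦ ∑ q : ↥𝒮ℒ ⧸ (Gamma0 N : Subgroup (GL (Fin 2) ℝ)).subgroupOf 𝒮ℒ,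
      ((((((rep q)⁻¹ • τ : ℍ)).im : ℝ) : ℂ)) ^ 2 * f ((rep q)⁻¹ • τ) *
      (S.Φ' u ((((rep q)⁻¹ • τ : ℍ)) : ℂ) 1 + I * S.Φ' u ((((rep q)⁻¹ • τ : ℍ)) : ℂ) I) with hAfun
  set Bfun : ℍ → ℂ := fun τ ↦ ∑ q : ↥𝒮ℒ ⧸ (Gamma0 N : Subgroup (GL (Fin 2) ℝ)).subgroupOf 𝒮ℒ,
      (-(2 * π * I) * UpperHalfPlane.petersson 2 ⇑u ⇑f ((rep q)⁻¹ • τ)) with hBfun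
  set Cfun : ℍ → ℂ := fun τ ↦ ∑ q : ↥𝒮ℒ ⧸ (Gamma0 N : Subgroup (GL (Fin 2) ℝ)).subgroupOf 𝒮ℒ,
      S.Cpart f ((rep q)⁻¹ • τ) with hCfun
  change ∫ τ in 𝒟, Afun τ = 0 at hA
  have hABC : ∀ τ, Cfun τ = Afun τ + Bfun τ := by
    intro τ
    simp only [hAfun, hBfun, hCfun, ← Finset.sum_add_distrib]
    refine Finset.sum_congr rfl fun q _ ↦ ?_
    rw [← reE_term_eq u f]
    simp only [Setup.Cpart, Setup.Φ', _root_.sub_apply, ContinuousLinearMap.coe_comp,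
      Function.comp_apply, Complex.ofRealCLM_apply]
    ring
  -- (B) the `re E_u`-part is `-2πi ⟨u, f⟩` and is integrable
  have hsm : ∀ (q : ↥𝒮ℒ ⧸ (Gamma0 N : Subgroup (GL (Fin 2) ℝ)).subgroupOf 𝒮ℒ) (τ : ℍ),
      ((Quotient.out q : ↥𝒮ℒ) : GL (Fin 2) ℝ)⁻¹ • τ = (rep q)⁻¹ • τ := by
    intro q τ
    rw [← rep_spec q, ← map_inv]; rfl
  have hB_val : ∫ τ in 𝒟, Bfun τ = -(2 * π * I) * peterssonProduct (Gamma0 N) 2 u f := by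
    rw [peterssonProduct_eq_setIntegral, ← integral_const_mul]
    refine setIntegral_congr_fun isClosed_fd.measurableSet fun τ _ ↦ ?_
    simp only [hBfun, Finset.mul_sum, hsm]
  have hB_int : IntegrableOn Bfun 𝒟 := by
    refine integrable_finsetSum _ fun q _ ↦ Integrable.const_mul ?_ _
    have h := integrableOn_petersson_slash_fd 2 u f (rep q)⁻¹
    refine h.congr_fun (fun τ _ ↦ ?_) isClosed_fd.measurableSet
    exact UpperHalfPlane.petersson_slash_SL 2 ⇑u ⇑f (rep q)⁻¹ τ
  -- (A') the `Φ`-part is integrable (bounded and continuous)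
  have hA_int : IntegrableOn Afun 𝒟 := by
    obtain ⟨Cf, hCf⟩ := CuspFormClass.exists_bound f
    have hCf' : ∀ σ : ℍ, σ.im * ‖f σ‖ ≤ Cf := fun σ ↦ by
      have h := hCf σ
      rw [show ((2 : ℤ) : ℝ) / 2 = 1 by norm_num, Real.rpow_one] at h
      rwa [le_div_iff₀ σ.im_pos, mul_comm] at h
    have hM'0 : 0 ≤ M' := by
      have h := hM' Complex.I (by simp)
      rw [Complex.I_im, div_one] at h
      exact (norm_nonneg _).trans h
    have hKb : ∀ σ : ℍ, ‖(((σ.im : ℝ) : ℂ)) ^ 2 * f σ * (S.Φ' u (σ : ℂ) 1 + I * S.Φ' u (σ : ℂ) I)‖ ≤ 2 * Cf * M' := by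
      intro σ
      have h1 : ‖S.Φ' u (σ : ℂ) 1‖ ≤ M' / σ.im := by
        refine (ContinuousLinearMap.le_opNorm _ _).trans ?_
        rw [norm_one, mul_one]; exact hM' _ σ.im_pos
      have h2 : ‖S.Φ' u (σ : ℂ) I‖ ≤ M' / σ.im := by
        refine (ContinuousLinearMap.le_opNorm _ _).trans ?_
        rw [Complex.norm_I, mul_one]; exact hM' _ σ.im_pos
      have h3 : ‖S.Φ' u (σ : ℂ) 1 + I * S.Φ' u (σ : ℂ) I‖ ≤ 2 * (M' / σ.im) := by
        refine (norm_add_le _ _).trans ?_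
        rw [norm_mul, Complex.norm_I, one_mul]; linarith
      rw [norm_mul, norm_mul, norm_pow, Complex.norm_real, Real.norm_of_nonneg σ.im_pos.le]
      calc σ.im ^ 2 * ‖f σ‖ * ‖S.Φ' u (σ : ℂ) 1 + I * S.Φ' u (σ : ℂ) I‖
          ≤ σ.im ^ 2 * ‖f σ‖ * (2 * (M' / σ.im)) := by gcongr
        _ = 2 * (σ.im * ‖f σ‖) * M' := by field_simp
        _ ≤ 2 * Cf * M' := by gcongr; exact hCf' σ
    have hKc : Continuous fun σ : ℍ ↦ (((σ.im : ℝ) : ℂ)) ^ 2 * f σ * (S.Φ' u (σ : ℂ) 1 + I * S.Φ' u (σ : ℂ) I) := by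
      have hΦ'h : Continuous fun σ : ℍ ↦ S.Φ' u (σ : ℂ) :=
        (S.continuousOn_Φ' u).comp_continuous UpperHalfPlane.continuous_coe fun σ ↦ σ.im_pos
      have h1 : Continuous fun σ : ℍ ↦ S.Φ' u (σ : ℂ) 1 := (ContinuousLinearMap.apply ℝ ℂ 1).continuous.comp hΦ'h
      have h2 : Continuous fun σ : ℍ ↦ S.Φ' u (σ : ℂ) I := (ContinuousLinearMap.apply ℝ ℂ I).continuous.comp hΦ'h
      exact (((Complex.continuous_ofReal.comp UpperHalfPlane.continuous_im).pow 2).mul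
        (ModularFormClass.holo f).continuous).mul (h1.add (continuous_const.mul h2))
    have hAc : Continuous Afun := by
      simp only [hAfun]
      exact continuous_finsetSum _ fun q _ ↦ hKc.comp (continuous_sl2z_smul _)
    refine Measure.integrableOn_of_bounded volume_fd_lt_top.ne hAc.aestronglyMeasurable
      (M := (Finset.univ : Finset (↥𝒮ℒ ⧸ (Gamma0 N : Subgroup (GL (Fin 2) ℝ)).subgroupOf 𝒮ℒ)).card • (2 * Cf * M'))
      (ae_of_all _ fun τ ↦ ?_)
    calc ‖Afun τ‖ ≤ ∑ q : ↥𝒮ℒ ⧸ (Gamma0 N : Subgroup (GL (Fin 2) ℝ)).subgroupOf 𝒮ℒ,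
          ‖((((((rep q)⁻¹ • τ : ℍ)).im : ℝ) : ℂ)) ^ 2 * f ((rep q)⁻¹ • τ) *
          (S.Φ' u ((((rep q)⁻¹ • τ : ℍ)) : ℂ) 1 + I * S.Φ' u ((((rep q)⁻¹ • τ : ℍ)) : ℂ) I)‖ := norm_sum_le _ _
      _ ≤ ∑ _q : (↥𝒮ℒ ⧸ (Gamma0 N : Subgroup (GL (Fin 2) ℝ)).subgroupOf 𝒮ℒ), 2 * Cf * M' :=
          Finset.sum_le_sum fun q _ ↦ hKb _
      _ = _ := Finset.sum_const _
  -- (C) the `U`-part unfolds to `∫_ℍ v`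
  have hC_val : ∫ τ in 𝒟, Cfun τ = S.sgn * cuspSymbol f S.δ₀ / (2 * π) := by
    have hU := Unfolding.integral_fd_sum_tsum_smul_eq (N := N) rep rep_spec (S.v f) (S.integrable_v f) (S.measurable_v f)
    rw [S.integral_v f] at hU
    have hpt : ∀ τ : ℍ, Cfun τ = (1 / 2 : ℂ) * ∑ q : ↥𝒮ℒ ⧸ (Gamma0 N : Subgroup (GL (Fin 2) ℝ)).subgroupOf 𝒮ℒ,
        ∑' δ : Gamma0 N, S.v f ((δ : SL(2, ℤ)) • (rep q)⁻¹ • τ) := by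
      intro τ
      simp only [hCfun, Finset.mul_sum, S.tsum_v_smul f]
      refine Finset.sum_congr rfl fun q _ ↦ by ring
    simp_rw [hpt]
    rw [integral_const_mul, hU]
    ring
  -- assemble: `∫ C = ∫ A + ∫ B`
  have hC_val' : ∫ τ in 𝒟, Cfun τ = 0 + -(2 * π * I) * peterssonProduct (Gamma0 N) 2 u f := by
    rw [← hA, ← hB_val, ← integral_add hA_int hB_int]
    exact setIntegral_congr_fun isClosed_fd.measurableSet fun τ _ ↦ hABC τ
  rw [hC_val, zero_add] at hC_val'
  have hπ : (π : ℂ) ≠ 0 := by exact_mod_cast Real.pi_ne_zero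
  have hI : I * I = -1 := Complex.I_mul_I
  -- `sgn φ / (2π) = -2πi P`, so `P = i sgn φ / (4π²)`
  have e : S.sgn * cuspSymbol f S.δ₀ = -(4 * π ^ 2 * I) * peterssonProduct (Gamma0 N) 2 u f := by
    have h := hC_val'
    field_simp at h
    linear_combination h
  rw [show I * S.sgn * cuspSymbol f S.δ₀ = I * (S.sgn * cuspSymbol f S.δ₀) by ring, e]
  have h4 : (4 * (π : ℂ) ^ 2) ≠ 0 := mul_ne_zero (by norm_num) (pow_ne_zero 2 hπ)
  rw [eq_div_iff h4]
  linear_combination (4 * (π : ℂ) ^ 2 * peterssonProduct (Gamma0 N) 2 u f) * hI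

end Identity

/-! ### From the pairing to the period relations -/

section Relations

variable {N : ℕ} [NeZero N]

/-- **A Riesz representative of `{∞, δ₀∞}` with periods in `ℝ + 4π² i ℤ`**: for the set-up `S` of a
hyperbolic `δ₀` there is `h ∈ S₂(Γ₀(N))` with `⟨h, f⟩ = {∞, δ₀∞}_f` for all `f` and
`im {∞, γ∞}_h ∈ 4π² ℤ` for all `γ ∈ Γ₀(N)` (`h = 4π² sign(ℓ) i · u`, `Setup.peterssonProduct_eq`,
`re {∞, γ∞}_u = p(γ) ∈ ℤ`). [folklore] -/
theorem Setup.exists_rieszRep (S : Setup N) : ∃ h : CuspForm (Gamma0 N) 2,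
    (∀ f, peterssonProduct (Gamma0 N) 2 h f = cuspSymbol f S.δ₀) ∧
      ∀ γ : Gamma0 N, ∃ n : ℤ, (cuspSymbol h γ).im = 4 * π ^ 2 * n := by
  obtain ⟨u, hu⟩ := S.exists_cuspForm
  set a : ℂ := 4 * π ^ 2 * S.sgn * I with ha
  have hsgn : conj S.sgn = S.sgn := by unfold Setup.sgn; split_ifs <;> simp
  refine ⟨a • u, fun f ↦ ?_, fun γ ↦ ?_⟩
  · rw [peterssonProduct_smul_left, S.peterssonProduct_eq hu f, ha]
    simp only [map_mul, hsgn, Complex.conj_I, map_pow, Complex.conj_ofReal]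
    have : (starRingEnd ℂ) (4 : ℂ) = 4 := map_ofNat _ 4
    rw [this]
    have hπ : (π : ℂ) ≠ 0 := by exact_mod_cast Real.pi_ne_zero
    field_simp
    have hI : I * I = -1 := Complex.I_mul_I
    have hs := S.sgn_mul_sgn
    linear_combination (-(S.sgn * S.sgn * cuspSymbol f S.δ₀)) * hI + (cuspSymbol f S.δ₀) * hs
  · obtain ⟨m, hm⟩ := DualForm.exists_int_dualPeriod_eq S.hξ S.hκ S.hκ1 S.hw S.hε S.hε' UpperHalfPlane.I γ
    have hre : (cuspSymbol u γ).re = m := by rw [hu]; exact hm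
    have him : (I * cuspSymbol u γ).im = m := by simp [Complex.mul_im, hre]
    rw [cuspSymbol_smul, ha]
    unfold Setup.sgn
    split_ifs
    · refine ⟨m, ?_⟩
      have e : (4 * (π : ℂ) ^ 2 * 1 * I * cuspSymbol u γ) = ((4 * π ^ 2 : ℝ) : ℂ) * (I * cuspSymbol u γ) := by
        push_cast; ring
      rw [e, Complex.im_ofReal_mul, him]
    · refine ⟨-m, ?_⟩
      have e : (4 * (π : ℂ) ^ 2 * (-1) * I * cuspSymbol u γ) = ((-(4 * π ^ 2) : ℝ) : ℂ) * (I * cuspSymbol u γ) := by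
        push_cast; ring
      rw [e, Complex.im_ofReal_mul, him]; push_cast; ring

omit [NeZero N] in
/-- **Cayley–Hamilton in `SL(2, ℤ)`**, entrywise: `(γ²)ᵢⱼ = t γᵢⱼ - δᵢⱼ`, `t = tr γ`. [folklore] -/
theorem mul_self_apply (γ : SL(2, ℤ)) (i j : Fin 2) :
    ((γ : Matrix (Fin 2) (Fin 2) ℤ) * (γ : Matrix (Fin 2) (Fin 2) ℤ)) i j =
      (γ 0 0 + γ 1 1) * γ i j - (1 : Matrix (Fin 2) (Fin 2) ℤ) i j := by
  have hdet := Matrix.SpecialLinearGroup.det_coe γ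
  rw [Matrix.det_fin_two] at hdet
  fin_cases i <;> fin_cases j <;>
    simp [Matrix.mul_apply, Fin.sum_univ_two] <;> first | ring1 | linear_combination (-1 : ℤ) * hdet

omit [NeZero N] in
/-- **Elements of small trace are torsion**: if `(tr γ)² ≤ 1` then `γ¹² = 1`. [folklore] -/
theorem pow_twelve_eq_one (γ : SL(2, ℤ)) (ht : (γ 0 0 + γ 1 1) ^ 2 ≤ 1) : γ ^ 12 = 1 := by
  set t : ℤ := γ 0 0 + γ 1 1 with htdef
  set M : Matrix (Fin 2) (Fin 2) ℤ := (γ : Matrix (Fin 2) (Fin 2) ℤ) with hM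
  have hsq : ∀ i j, (M * M) i j = t * M i j - (1 : Matrix (Fin 2) (Fin 2) ℤ) i j := mul_self_apply γ
  have hcases : t = 0 ∨ t = 1 ∨ t = -1 := by
    have : -1 ≤ t ∧ t ≤ 1 := by constructor <;> nlinarith
    omega
  -- `M^12 = 1` in each case
  have h12 : M ^ 12 = 1 := by
    rcases hcases with h | h | h
    · have h2 : M ^ 2 = -1 := by
        rw [pow_two]; ext i j; rw [hsq, h]; simp
      calc M ^ 12 = (M ^ 2) ^ 6 := by rw [← pow_mul]
        _ = 1 := by rw [h2]; norm_num
    · have h2 : M * M = M - 1 := by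
        ext i j; rw [hsq, h, Matrix.sub_apply]; simp
      have h3 : M ^ 3 = -1 := by
        rw [pow_succ, pow_two, h2, sub_mul, one_mul, h2]; abel
      calc M ^ 12 = (M ^ 3) ^ 4 := by rw [← pow_mul]
        _ = 1 := by rw [h3]; norm_num
    · have h2 : M * M = -M - 1 := by
        ext i j; rw [hsq, h, Matrix.sub_apply, Matrix.neg_apply]; simp
      have h3 : M ^ 3 = 1 := by
        rw [pow_succ, pow_two, h2, sub_mul, neg_mul, one_mul, h2]; abel
      calc M ^ 12 = (M ^ 3) ^ 4 := by rw [← pow_mul]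
        _ = 1 := by rw [h3, one_pow]
  apply Subtype.ext
  rw [Matrix.SpecialLinearGroup.coe_pow]
  exact h12

/-- **Period functionals of torsion elements vanish**: `{∞, γ∞} = 0` if `(tr γ)² ≤ 1`. [folklore] -/
theorem periodFunctional_eq_zero_of_trace (γ : Gamma0 N) (ht : ((γ : SL(2, ℤ)) 0 0 + (γ : SL(2, ℤ)) 1 1) ^ 2 ≤ 1) :
    periodFunctional N γ = 0 := by
  have h12 : γ ^ 12 = 1 := Subtype.ext (by rw [Subgroup.coe_pow]; exact pow_twelve_eq_one _ ht)
  have hpow : ∀ n : ℕ, periodFunctional N (γ ^ n) = n • periodFunctional N γ := by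
    intro n
    induction n with
    | zero => simp
    | succ n ih => rw [pow_succ, periodFunctional_mul, ih, succ_nsmul]
  have h := hpow 12
  rw [h12, periodFunctional_one] at h
  have h' : ((12 : ℕ) : ℂ) • periodFunctional N γ = 0 := by
    rw [Nat.cast_smul_eq_nsmul ℂ]; exact h.symm
  exact (smul_eq_zero.mp h').resolve_left (by norm_num)

omit [NeZero N] in
/-- The element `A = (1 1; N N+1) ∈ Γ₀(N)`. [folklore] -/
theorem exists_hyperbolic_mem : ∃ A : SL(2, ℤ), A ∈ Gamma0 N ∧ A 0 0 + A 1 1 = N + 2 := by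
  refine ⟨⟨!![1, 1; (N : ℤ), (N : ℤ) + 1], by rw [Matrix.det_fin_two_of]; ring⟩, ?_, ?_⟩
  · rw [Gamma0_mem]
    simp
  · simp; ring

omit [NeZero N] in
/-- **Trace identity**: `tr(γA) + tr(γA⁻¹) = tr(γ) tr(A)` in `SL(2, ℤ)`. [folklore] -/
theorem trace_mul_add_trace_mul_inv (γ A : SL(2, ℤ)) :
    ((γ * A) 0 0 + (γ * A) 1 1) + ((γ * A⁻¹) 0 0 + (γ * A⁻¹) 1 1) = (γ 0 0 + γ 1 1) * (A 0 0 + A 1 1) := by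
  rw [Matrix.SpecialLinearGroup.SL2_inv_expl A]
  simp [Matrix.mul_apply, Fin.sum_univ_two]
  ring

/-- **Every period functional is an integral combination of period functionals of hyperbolic
elements**: torsion elements contribute `0` (`periodFunctional_eq_zero_of_trace`), hyperbolic ones
themselves, and for a parabolic `γ` (`(tr γ)² = 4`) one of `γA^{±1}` is hyperbolic for the
hyperbolic `A = (1 1; N N+1)`, with `{∞, γ∞} = {∞, γA^{±1}∞} - {∞, A^{±1}∞}`. [folklore] -/
theorem periodFunctional_mem_closure_hyperbolic (γ : Gamma0 N) :
    periodFunctional N γ ∈ AddSubgroup.closure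
      {φ | ∃ δ : Gamma0 N, 4 < ((δ : SL(2, ℤ)) 0 0 + (δ : SL(2, ℤ)) 1 1) ^ 2 ∧ φ = periodFunctional N δ} := by
  set Hyp : Set (Module.Dual ℂ (CuspForm (Gamma0 N) 2)) :=
    {φ | ∃ δ : Gamma0 N, 4 < ((δ : SL(2, ℤ)) 0 0 + (δ : SL(2, ℤ)) 1 1) ^ 2 ∧ φ = periodFunctional N δ} with hHyp
  set t : ℤ := (γ : SL(2, ℤ)) 0 0 + (γ : SL(2, ℤ)) 1 1 with ht
  by_cases h4 : 4 < t ^ 2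
  · exact AddSubgroup.subset_closure ⟨γ, h4, rfl⟩
  by_cases h1 : t ^ 2 ≤ 1
  · rw [periodFunctional_eq_zero_of_trace γ h1]; exact zero_mem _
  · -- parabolic: `t² = 4`
    have ht2 : t ^ 2 = 4 := by
      have habs : -2 ≤ t ∧ t ≤ 2 := by constructor <;> nlinarith
      have : ¬ (-1 ≤ t ∧ t ≤ 1) := fun h ↦ h1 (by nlinarith [h.1, h.2])
      rcases habs with ⟨ha, hb⟩
      have : t = 2 ∨ t = -2 := by omega
      rcases this with h | h <;> rw [h] <;> norm_num
    have hN : 1 ≤ N := Nat.one_le_iff_ne_zero.mpr (NeZero.ne N)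
    obtain ⟨A, hA, htrA⟩ := exists_hyperbolic_mem (N := N)
    set A' : Gamma0 N := ⟨A, hA⟩ with hA'
    have hid := trace_mul_add_trace_mul_inv (γ : SL(2, ℤ)) A
    rw [← ht, htrA] at hid
    -- one of `γA`, `γA⁻¹` is hyperbolic
    have hAhyp : 4 < (A 0 0 + A 1 1) ^ 2 := by
      rw [htrA]; nlinarith
    have htrAinv : (A⁻¹ : SL(2, ℤ)) 0 0 + (A⁻¹ : SL(2, ℤ)) 1 1 = A 0 0 + A 1 1 := by
      rw [Matrix.SpecialLinearGroup.SL2_inv_expl A]; simp; ring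
    have hAinvhyp : 4 < ((A⁻¹ : SL(2, ℤ)) 0 0 + (A⁻¹ : SL(2, ℤ)) 1 1) ^ 2 := by
      rw [htrAinv]; exact hAhyp
    set x : ℤ := ((γ : SL(2, ℤ)) * A) 0 0 + ((γ : SL(2, ℤ)) * A) 1 1 with hx
    set y : ℤ := ((γ : SL(2, ℤ)) * A⁻¹) 0 0 + ((γ : SL(2, ℤ)) * A⁻¹) 1 1 with hy
    have hsum : x + y = t * (N + 2) := hid
    have hor : 4 < x ^ 2 ∨ 4 < y ^ 2 := by
      by_contra hcon
      push Not at hcon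
      obtain ⟨hx', hy'⟩ := hcon
      have hxb : -2 ≤ x ∧ x ≤ 2 := by constructor <;> nlinarith
      have hyb : -2 ≤ y ∧ y ≤ 2 := by constructor <;> nlinarith
      have hNz : (1 : ℤ) ≤ N := by exact_mod_cast hN
      have ht' : t = 2 ∨ t = -2 := by
        have hprod : (t - 2) * (t + 2) = 0 := by linear_combination ht2
        rcases mul_eq_zero.mp hprod with h | h
        · left; linarith
        · right; linarith
      rcases ht' with h | h <;> rw [h] at hsum <;> linarith [hxb.1, hxb.2, hyb.1, hyb.2]
    rcases hor with h | h
    · have e : periodFunctional N γ = periodFunctional N (γ * A') - periodFunctional N A' := by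
        rw [periodFunctional_mul]; abel
      rw [e]
      refine sub_mem (AddSubgroup.subset_closure ⟨γ * A', ?_, rfl⟩) (AddSubgroup.subset_closure ⟨A', hAhyp, rfl⟩)
      exact h
    · have e : periodFunctional N γ = periodFunctional N (γ * A'⁻¹) - periodFunctional N A'⁻¹ := by
        rw [periodFunctional_mul]; abel
      rw [e]
      refine sub_mem (AddSubgroup.subset_closure ⟨γ * A'⁻¹, ?_, rfl⟩) (AddSubgroup.subset_closure ⟨A'⁻¹, ?_, rfl⟩)
      · exact h
      · exact hAinvhyp

/-- **Riemann's period relations for `X₀(N)` in Petersson form.** For `ψ` in the period homology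
`H ⊆ S₂(Γ₀(N))^∨` with Petersson–Riesz representative `h` (`ψ = ⟨h, ·⟩`) and `φ ∈ H`:
`im φ(h) ∈ 4π² ℤ`. This is Farkas–Kra III.1.1 (1.1.1) with II.3.3 and III.2.3 (`φ(h) = ∬ ω_h ∧ *η`
and the integrality of intersection numbers) on the compact Riemann surface `X₀(N)`, proved here on
`ℍ`: every class in `H` is an integral combination of classes of hyperbolic elements
(`periodFunctional_mem_closure_hyperbolic`), whose Riesz representatives are the forms
`4π² sign(ℓ) i u` of `Setup.exists_rieszRep` with `re {∞, γ∞}_u ∈ ℤ`. [cite: FarkasKra1992, III.1.1 (1.1.1), II.3.3, III.2.3] -/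
theorem periodRelations : ∀ ψ ∈ periodHomology N, ∀ h : CuspForm (Gamma0 N) 2,
    (∀ g, ψ g = peterssonProduct (Gamma0 N) 2 h g) →
      ∀ φ ∈ periodHomology N, ∃ n : ℤ, (φ h).im = 4 * Real.pi ^ 2 * n := by
  -- the good classes: those with a Riesz representative whose periods have imaginary parts in `4π²ℤ`
  set Good : AddSubgroup (Module.Dual ℂ (CuspForm (Gamma0 N) 2)) :=
    { carrier := {ψ | ∃ hψ : CuspForm (Gamma0 N) 2, (∀ g, ψ g = peterssonProduct (Gamma0 N) 2 hψ g) ∧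
        ∀ γ : Gamma0 N, ∃ n : ℤ, (cuspSymbol hψ γ).im = 4 * π ^ 2 * n}
      zero_mem' := by
        refine ⟨0, fun g ↦ by rw [peterssonProduct_zero_left]; rfl, fun γ ↦ ⟨0, ?_⟩⟩
        rw [← periodFunctional_apply, map_zero]; simp
      add_mem' := by
        rintro ψ₁ ψ₂ ⟨h₁, hP₁, hn₁⟩ ⟨h₂, hP₂, hn₂⟩
        refine ⟨h₁ + h₂, fun g ↦ ?_, fun γ ↦ ?_⟩
        · rw [LinearMap.add_apply, hP₁, hP₂, peterssonProduct_add_left]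
        · obtain ⟨n₁, e₁⟩ := hn₁ γ
          obtain ⟨n₂, e₂⟩ := hn₂ γ
          refine ⟨n₁ + n₂, ?_⟩
          rw [cuspSymbol_add, Complex.add_im, e₁, e₂]; push_cast; ring
      neg_mem' := by
        rintro ψ ⟨h₁, hP₁, hn₁⟩
        refine ⟨(-1 : ℂ) • h₁, fun g ↦ ?_, fun γ ↦ ?_⟩
        · rw [LinearMap.neg_apply, hP₁, peterssonProduct_smul_left]; simp
        · obtain ⟨n₁, e₁⟩ := hn₁ γ
          refine ⟨-n₁, ?_⟩
          rw [cuspSymbol_smul, neg_one_mul, Complex.neg_im, e₁]; push_cast; ring } with hGood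
  -- hyperbolic classes are good
  have hhyp : {φ | ∃ δ : Gamma0 N, 4 < ((δ : SL(2, ℤ)) 0 0 + (δ : SL(2, ℤ)) 1 1) ^ 2 ∧ φ = periodFunctional N δ} ⊆
      (Good : Set (Module.Dual ℂ (CuspForm (Gamma0 N) 2))) := by
    rintro φ ⟨δ, hδ, rfl⟩
    obtain ⟨S, hS⟩ := exists_setup (N := N) (δ : SL(2, ℤ)) δ.2 hδ
    obtain ⟨hδ', h1, h2⟩ := S.exists_rieszRep
    refine ⟨hδ', fun g ↦ ?_, h2⟩
    rw [periodFunctional_apply, h1 g, hS]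
  -- hence every class is good
  have hH : periodHomology N ≤ Good := by
    rw [periodHomology, AddSubgroup.closure_le]
    rintro φ ⟨γ, rfl⟩
    exact ((AddSubgroup.closure_le Good).mpr hhyp) (periodFunctional_mem_closure_hyperbolic γ)
  -- conclusion
  intro ψ hψ h hh φ hφ
  obtain ⟨h', hP', hn'⟩ := hH hψ
  -- `h = h'` by nondegeneracy
  have hsub : ∀ g, peterssonProduct (Gamma0 N) 2 (h - h') g = 0 := by
    intro g
    have e := peterssonProduct_add_left (Gamma0 N : Subgroup (GL (Fin 2) ℝ)) 2 (h - h') h' g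
    rw [sub_add_cancel, ← hh g, hP' g] at e
    linear_combination -e
  have heq : h = h' := by
    have := eq_zero_of_peterssonProduct_self_eq_zero 2 (h - h') (hsub _)
    exact sub_eq_zero.mp this
  subst heq
  -- induction over the period homology
  have hφ' : φ ∈ AddSubgroup.closure (Set.range (periodFunctional N)) := hφ
  clear hφ
  induction hφ' using AddSubgroup.closure_induction with
  | mem x hx =>
    obtain ⟨γ, rfl⟩ := hx
    obtain ⟨n, hn⟩ := hn' γ
    exact ⟨n, by rw [periodFunctional_apply, hn]⟩
  | zero => exact ⟨0, by simp⟩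
  | add x y _ _ ihx ihy =>
    obtain ⟨n₁, e₁⟩ := ihx
    obtain ⟨n₂, e₂⟩ := ihy
    exact ⟨n₁ + n₂, by rw [LinearMap.add_apply, Complex.add_im, e₁, e₂]; push_cast; ring⟩
  | neg x _ ih =>
    obtain ⟨n₁, e₁⟩ := ih
    exact ⟨-n₁, by rw [LinearMap.neg_apply, Complex.neg_im, e₁]; push_cast; ring⟩

end Relations

/-! ### Pasten's Theorem 5.5 -/

/-- **Pasten, *Shimura curves and the abc conjecture*, Thm. 5.5** (`PastenShimura2024_thm_5_5`),
discharged: for an optimal quotient `q : J₀(N) → A` attached to `[f]` and a finite set `S` of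
maximal ideals of `𝕋 = 𝕋_{[f]} × 𝕋_{[f]^⊥}`, the `S`-modular degree divides the product of the
congruence moduli `η_{[f]}(𝔭)` over the minimal primes `𝔭 ∉ S`, `𝔭 ≠ I_{[f]}` — here in the tree's
form for the modular parametrisation of an elliptic curve, `deg φ ∣ ∏_{𝔭 ≠ I_f} η_f(𝔭)`. The
tree had reduced it (`PastenShimura2024_thm_5_5_of_periodRelations`, Pasten §5.6 with Ribet's
`deg ∣ congruence number` in homological form) to Riemann's period relations for `X₀(N)` in
Petersson form, proved above (`PeriodRelations.periodRelations`).
[cite: PastenShimura2024, Thm. 5.5 (§5.6)] -/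
theorem _root_.Literature.NumberTheory.EllipticCurves.ModularForms.PastenShimura2024_thm_5_5_holds :
    PastenShimura2024_thm_5_5 :=
  PastenShimura2024_thm_5_5_of_periodRelations fun N _ ↦ PeriodRelations.periodRelations (N := N)

end PeriodRelations

end Literature.NumberTheory.EllipticCurves.ModularForms

end
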